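import Summits.ResolutionOfSingularities.ResolutionOfSingularities.Theorems.MarkedTransferCampaignW46CuspStaircasePermissibleRun
import Summits.ResolutionOfSingularities.ResolutionOfSingularities.Theorems.FrobeniusLadderFInjectiveMacaulayficationBadPointsClosed
import Literature.AlgebraicGeometry.Resolution.OrderSemicontinuityPointwise
import HarnessLib

/-!
# [OURS · L1 W4.6, rung (iii)] The cusp staircase, XII — the clause «`Sing(E)` consists of closed points» is automatic:
# minimal forms of the two curve regimes (cell res-hironaka, LADDER-RESOLUTION rung L, D-0089; slot W4.6, seat
# res-L1-s46-pv-5 gen 3; host route MarkedTransfer, `--kind proof --supports stmt-ResolutionOfSingularities-16155 --as helper`)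

HONEST FRAMING. Everything below is OURS and elementary: kernel theorems about the campaign definitions
`CampaignW46.Regime.mohWindowCurve` (p472581) and `Regime.cuspCurve` (p482083), assembled from tree facts — orders do not
decrease under specialisation on a regular scheme (`Resolution.stableUnderSpecialization_setOf_le_idealOrder`,
Cossart–Piltant 2008 Prop. 4.2), a finite specialisation-stable set of a Jacobson space consists of closed points
(`isClosed_singleton_of_stableUnderSpecialization_finite`, route FrobeniusLadder file `…BadPointsClosed.lean`), and the
ambient scheme of a row-001 ambient datum is regular and Jacobson (seat pv-1's `ambient_isRegular`,
`ambient_jacobsonSpace`). NOTHING here is a statement of H. Hironaka's manuscript *Resolution of singularities in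
positive characteristics* (2017-03-23, [Hironaka2017]) and nothing here asserts that any statement of it holds. No
FACT-LIST premise is used. AI review is weaker than expert review. No `sorry`; axioms standard.

## What is proved (namespace `…Theorems.CampaignW46`)

* `sing_subset_closedPoints_of_finite` — for EVERY state `(A, E)` of the typed procedure: if `Sing(E)` is finite then it
  consists of closed points of `A.Z` (`Sing(E) = {x | b ≤ ord_x J}` is specialisation-stable on the regular `A.Z`; a
  non-closed point of a Jacobson space has infinite closure).
* `Regime.cuspCurve_iff_finite`, `Regime.mohWindowCurve_iff_finite` — hence the clause «`Sing(E) ⊆` closed points» of both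
  regimes is REDUNDANT: `Regime.cuspCurve A E ↔ 0 < b ∧ Sing(E) finite ∧ (cusp germ at every singular point)`,
  `Regime.mohWindowCurve A E ↔ Sing(E) finite ∧ (window germ at every singular point)` — the regimes are exactly «finitely
  many singular points, each a cusp / window germ», the minimal reading of RESCUE-SEED W4.6 (iii) on curves.
* `FinPermissibleRun.len_le_of_finite_cuspAt` — the geometric rung (file XI `FinPermissibleRun.len_le_sum_div_of_cuspCurve`)
  restated on the minimal hypotheses.

## References

* V. Cossart, O. Piltant, *Resolution of singularities of threefolds in positive characteristic I*, J. Algebra 320 (2008),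
  Prop. 4.2 (tree `OrderSemicontinuityPointwise.lean`). [cite: CossartPiltant2008, Prop. 4.2]
* The Stacks Project, Tag 01TB / 005X (Jacobson spaces). Seat pv-1 `…LiteralCentreProcrastination.lean`; this seat files I–XI.
* H. Hironaka, ms. 2017-03-23, §2 p.4 l.34 («`Y_cl`»), §2.1 p.4 l.35–39 — scope only, under adjudication, not cited as
  fact. [Hironaka2017]
-/

noncomputable section

set_option linter.dupNamespace false -- mandated namespace of this single-conjunct summit

open CategoryTheory AlgebraicGeometry TopologicalSpace IsLocalRing

namespace Summit.ResolutionOfSingularities.ResolutionOfSingularities.Theorems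

namespace CampaignW46

open Literature.AlgebraicGeometry.Resolution
open Literature.AlgebraicGeometry.Hironaka2017.S02Preliminaries
open Literature.AlgebraicGeometry.Hironaka2017.Datum

universe u

variable {p : ℕ} [Fact p.Prime] {K : Type u} [Field K] [CharP K p]

/-- [OURS · L1 W4.6 rung (iii); NOT a statement of the manuscript] **A finite singular locus consists of closed points.**
For every state `(A, E)` of the typed procedure (ambient datum `A` over `K`, ideal exponent `E = (J, b)` on `A.Z`): if
`Sing(E) = {x | b ≤ ord_x J}` is finite, then every point of it is a closed point of `A.Z` — `Sing(E)` is stable under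
specialisation because orders do not decrease under specialisation on the regular scheme `A.Z` (Cossart–Piltant 2008
Prop. 4.2, tree), and a finite specialisation-stable subset of the Jacobson space `A.Z` consists of closed points.
[cite: CossartPiltant2008, Prop. 4.2] -/
theorem sing_subset_closedPoints_of_finite (A : AmbientDatum p K) (E : IdealExponent A.Z) (hfin : E.sing.Finite) :
    E.sing ⊆ Literature.AlgebraicGeometry.Hironaka2017.S02Preliminaries.closedPoints A.Z := fun ξ hξ => by
  haveI : JacobsonSpace A.Z := ambient_jacobsonSpace A
  exact FInjectiveMacaulayfication.BadPointsClosed.isClosed_singleton_of_stableUnderSpecialization_finite hfin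
    (stableUnderSpecialization_setOf_le_idealOrder (ambient_isRegular A) E.J E.b) hξ

/-- [OURS · L1 W4.6 rung (iii); NOT a statement of the manuscript] **Minimal form of the staircase regime**: the clause
«`Sing(E) ⊆` closed points» of `Regime.cuspCurve` is redundant — `(A, E)` is a staircase state iff `0 < b`, `Sing(E)` is
finite and `J_ξ` is a cusp germ of exponent `b` at every `ξ ∈ Sing(E)`. [folklore] -/
theorem Regime.cuspCurve_iff_finite (A : AmbientDatum p K) (E : IdealExponent A.Z) :
    Regime.cuspCurve (p := p) (K := K) A E ↔
      0 < E.b ∧ E.sing.Finite ∧ ∀ ξ ∈ E.sing, CuspAt E.b (A.Z.presheaf.stalk ξ) (stalkIdeal E.J ξ) :=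
  ⟨fun h => ⟨h.1, h.2.1, h.2.2.2⟩,
    fun h => ⟨h.1, h.2.1, sing_subset_closedPoints_of_finite A E h.2.1, h.2.2⟩⟩

/-- [OURS · L1 W4.6 rung (iii); NOT a statement of the manuscript] **Minimal form of the window regime**: `(A, E)` is a
window state iff `Sing(E)` is finite and `J_ξ` is a window germ of exponent `b` at every `ξ ∈ Sing(E)`. [folklore] -/
theorem Regime.mohWindowCurve_iff_finite (A : AmbientDatum p K) (E : IdealExponent A.Z) :
    Regime.mohWindowCurve (p := p) (K := K) A E ↔
      E.sing.Finite ∧ ∀ ξ ∈ E.sing, MohWindowAt E.b (A.Z.presheaf.stalk ξ) (stalkIdeal E.J ξ) :=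
  ⟨fun h => ⟨h.1, h.2.2⟩, fun h => ⟨h.1, sing_subset_closedPoints_of_finite A E h.1, h.2⟩⟩

/-- [OURS · L1 W4.6 rung (iii); NOT a statement of the manuscript] **The geometric staircase rung on the minimal
hypotheses**: every finite §2.1-permissible blow-up sequence whose stage `0` has `0 < b`, finitely many singular points and
a cusp germ of exponent `b` at each of them has length at most `Σ(E₀)/b`
(`FinPermissibleRun.len_le_sum_div_of_cuspCurve` + `Regime.cuspCurve_iff_finite`). [folklore] -/
theorem FinPermissibleRun.len_le_of_finite_cuspAt (r : FinPermissibleRun p K) (hb : 0 < (r.E 0).b)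
    (hfin : (r.E 0).sing.Finite)
    (hcusp : ∀ ξ ∈ (r.E 0).sing, CuspAt (r.E 0).b ((r.A 0).Z.presheaf.stalk ξ) (stalkIdeal (r.E 0).J ξ)) :
    r.len ≤ (cuspMultiset (r.E 0)).sum / (r.E 0).b :=
  r.len_le_sum_div_of_cuspCurve ((Regime.cuspCurve_iff_finite (r.A 0) (r.E 0)).mpr ⟨hb, hfin, hcusp⟩)

/-- [OURS · L1 W4.6 rung (iii); NOT a statement of the manuscript] **The geometric window rung on the minimal hypotheses**:
every finite §2.1-permissible blow-up sequence whose stage `0` has finitely many singular points, each carrying a window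
germ, has length at most `#Sing(E₀)`. [folklore] -/
theorem FinPermissibleRun.len_le_of_finite_mohWindowAt (r : FinPermissibleRun p K) (hfin : (r.E 0).sing.Finite)
    (hwin : ∀ ξ ∈ (r.E 0).sing, MohWindowAt (r.E 0).b ((r.A 0).Z.presheaf.stalk ξ) (stalkIdeal (r.E 0).J ξ)) :
    r.len ≤ (r.E 0).sing.ncard :=
  r.len_le_ncard_of_mohWindowCurve ((Regime.mohWindowCurve_iff_finite (r.A 0) (r.E 0)).mpr ⟨hfin, hwin⟩)

end CampaignW46

end Summit.ResolutionOfSingularities.ResolutionOfSingularities.Theorems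

end
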